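import Literature.Probability.RandomPlanarGeometry.PlanarDomains
import Literature.Topology.PlaneTopology.Crosscut
import HarnessLib

/-!
# Local connectedness of the boundary loop at a parameter — helper for `DiscretisationFamilyExists` (stmt-CriticalPhenomena-9644)

`boundary_localization`: for the boundary loop of a Jordan domain, a parameter `m` and
`η, κ₀ > 0` there are `0 < κ ≤ κ₀` and `0 < η₁ ≤ η` such that parameters within `κ` of `m` are
mapped into `ball (boundary m) η`, and conversely a parameter of the half-period window about `m`
whose image is within `η₁` of `boundary m` is within `κ` of `m` (compactness of the image of the
window with the `κ`-neighbourhood of `m` removed, and injectivity of the loop on a period).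
-/

noncomputable section

open Set Metric
open Literature.Probability.RandomPlanarGeometry Literature.Topology.PlaneTopology

namespace Summit.CriticalPhenomena.CardyFormulaZ2.Theorems.DiscretisationFamilyExists

/-- **Local connectedness of the boundary loop at a parameter.** See the module docstring.
[folklore] -/
theorem boundary_localization (J : JordanDomain) (m : ℝ) {η κ₀ : ℝ} (hη : 0 < η) (hκ₀ : 0 < κ₀) :
    ∃ κ η₁ : ℝ, 0 < κ ∧ κ ≤ κ₀ ∧ 0 < η₁ ∧ η₁ ≤ η ∧
      (∀ u : ℝ, |u - m| ≤ κ → dist (J.boundary u) (J.boundary m) < η) ∧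
      (∀ u ∈ Icc (m - 1 / 2) (m + 1 / 2), dist (J.boundary u) (J.boundary m) < η₁ → |u - m| < κ) := by
  -- continuity at `m`
  obtain ⟨κ₁, hκ₁, hcont⟩ := Metric.continuous_iff.1 J.continuous_boundary m η hη
  set κ := min (κ₁ / 2) (min κ₀ (1 / 4)) with hκ
  have hκpos : 0 < κ := by positivity
  have hκκ₁ : κ < κ₁ := by
    have : κ ≤ κ₁ / 2 := min_le_left _ _
    linarith
  have hκ4 : κ ≤ 1 / 4 := (min_le_right _ _).trans (min_le_right _ _)
  have hnear : ∀ u : ℝ, |u - m| ≤ κ → dist (J.boundary u) (J.boundary m) < η := fun u hu =>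
    hcont u (by rw [Real.dist_eq]; exact hu.trans_lt hκκ₁)
  -- the far part of the window and its compact image
  set T : Set ℝ := Icc (m - 1 / 2) (m - κ) ∪ Icc (m + κ) (m + 1 / 2) with hT
  have hTc : IsCompact T := isCompact_Icc.union isCompact_Icc
  set K := J.boundary '' T with hK
  have hKc : IsCompact K := hTc.image J.continuous_boundary
  have hKne : K.Nonempty := ⟨J.boundary (m - 1 / 2), mem_image_of_mem _ (Or.inl ⟨le_rfl, by linarith⟩)⟩
  -- `boundary m ∉ K` by injectivity on the period `[m - 1/2, m + 1/2)`
  have hinj := J.injOn_boundary_Ico (m - 1 / 2)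
  have hmK : J.boundary m ∉ K := by
    rintro ⟨u, hu, heq⟩
    have hm : m ∈ Ico (m - 1 / 2) (m - 1 / 2 + 1) := ⟨by linarith, by linarith⟩
    rcases hu with hu | hu
    · have hu' : u ∈ Ico (m - 1 / 2) (m - 1 / 2 + 1) := ⟨hu.1, by linarith [hu.2]⟩
      have := hinj hu' hm heq
      linarith [hu.2]
    · rcases eq_or_lt_of_le hu.2 with h | h
      · -- `u = m + 1/2`: its image is that of `m - 1/2`
        have heq' : J.boundary (m - 1 / 2) = J.boundary m := by
          rw [← heq, h, show m + 1 / 2 = m - 1 / 2 + 1 by ring, J.periodic_boundary]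
        have hu' : m - 1 / 2 ∈ Ico (m - 1 / 2) (m - 1 / 2 + 1) := ⟨le_rfl, by linarith⟩
        have := hinj hu' hm heq'
        linarith
      · have hu' : u ∈ Ico (m - 1 / 2) (m - 1 / 2 + 1) := ⟨by linarith [hu.1], by linarith⟩
        have := hinj hu' hm heq
        linarith [hu.1]
  -- the distance of `boundary m` to `K`
  have hd : 0 < infDist (J.boundary m) K := (hKc.isClosed.notMem_iff_infDist_pos hKne).1 hmK
  set η₁ := min (infDist (J.boundary m) K) η with hη₁
  refine ⟨κ, η₁, hκpos, (min_le_right _ _).trans (min_le_left _ _), lt_min hd hη, min_le_right _ _,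
    hnear, fun u hu hdist => ?_⟩
  by_contra hfar
  push Not at hfar
  have huT : u ∈ T := by
    rcases le_or_gt u m with h | h
    · left; exact ⟨hu.1, by rw [abs_of_nonpos (by linarith)] at hfar; linarith⟩
    · right; exact ⟨by rw [abs_of_pos (by linarith)] at hfar; linarith, hu.2⟩
  have : infDist (J.boundary m) K ≤ dist (J.boundary m) (J.boundary u) :=
    infDist_le_dist_of_mem (mem_image_of_mem _ huT)
  rw [dist_comm] at this
  linarith [min_le_left (infDist (J.boundary m) K) η]

end Summit.CriticalPhenomena.CardyFormulaZ2.Theorems.DiscretisationFamilyExists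

end
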